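import Summits.ResolutionOfSingularities.ResolutionOfSingularities.Theorems.FrobeniusLadderFInjectiveMacaulayficationTauFloorOneCIChartCore
import Summits.ResolutionOfSingularities.ResolutionOfSingularities.Theorems.FrobeniusLadderFInjectiveMacaulayficationFCentreE1ChartPresentation
import Mathlib.RingTheory.Localization.Away.Basic
import HarnessLib

/-!
# F4POS-1 (d-B): the CI chart `C = k[x,y,w,u′,t′,z′]/(x² − wy, z′² + y(1 + w²z′ + u′³ + t′³))` is an INTEGRAL DOMAIN — it embeds into `A₀[1/y]`
# (crux `FInjectiveMacaulayfication` stmt-ResolutionOfSingularities-15315, chain w45a; res-L1-w45a-plan-1 CHAIN v31.7 «F4POS-1 (d)»; seat res-L1-w45a-stub-1 g10)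

[OURS · L1 W4.5a] Support file (`--supports stmt-ResolutionOfSingularities-15315 --as helper`); def-free, unconditional; replaces the role of NO printed item;
NOT a statement of the manuscript; AI-written (AI review is weaker than expert review).

`A₀ = k[X₀..X₄]/(f)`, `f = X₄² + X₀⁴X₄ + X₁³ + X₂³ + X₃³` (P2d4C, `char k = 2`), `C = k[X₀..X₅]/(g₁, g₂)` the chart `D(y)` ring of `…TauFloorOneCIChartCore`.
* §1 `mk_X_one_mem_nonZeroDivisors` — `ȳ` is a non-zero-divisor of `C` (as for `x̄`: `g₁'` prime, `g₁' ∤ y`).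
* §2 THE CHART MAP `φ : C → A₀[1/ȳ]`, `x,y ↦ x,y`, `w ↦ x²/y`, `u′ ↦ u/y`, `t′ ↦ t/y`, `z′ ↦ z/y` (`exists_chartMap`: kills `g₁` and `g₂ = y⁻²·f`), and THE
  BLOW-DOWN MAP `ψ₁ : A₀ → C`, `u ↦ u′y`, `t ↦ t′y`, `z ↦ z′y` (`exists_blowdownMap`: kills `f = y²·g₂ + …`); `ψ₁` extended to `A₀[1/ȳ] → C[1/ȳ]` inverts `φ`
  after `C → C[1/ȳ]` (`blowdown_comp_chartMap`), which is injective (§1); hence ★ `chartMap_injective`.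
* §3 ★★ `isDomain` — `C` is a domain (a subring of the domain `A₀[1/ȳ]`); `isPrime_span_pair` — `(g₁, g₂)` is a prime of `k[X₀..X₅]`.
This is the injectivity half of the identification `C ≅ A₀[τ/ȳ] = blowupAlgebra τ ȳ` (the range half is the next file). [folklore, OURS as a certificate]
-/

-- single-problem summit: the doubled namespace component is forced
set_option linter.dupNamespace false

noncomputable section

namespace Summit.ResolutionOfSingularities.ResolutionOfSingularities.Theorems.FInjectiveMacaulayfication.TauFloorOneCIChartDomain

open MvPolynomial IsLocalization
open Summit.ResolutionOfSingularities.ResolutionOfSingularities.Theorems.FInjectiveMacaulayfication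
open TauFloorOneCIChartCore

variable (k : Type) [Field k]

/-! ## §1 `ȳ` is a non-zero-divisor of `C` -/

/-- `g₁' = x² − wy` does not divide `y` (evaluate at `(0,1,0,0,0)`). [folklore] -/
theorem not_dvd_X_one (g : MvPolynomial (Fin 5) k) (hg : g = X 0 ^ 2 - X 2 * X 1) : ¬ g ∣ X 1 := by
  rintro ⟨q, hq⟩
  have h := congrArg (MvPolynomial.eval (Pi.single 1 1 : Fin 5 → k)) hq
  rw [map_mul, hg] at h
  simp at h

/-- ★ **`ȳ = X̄₁` is a non-zero-divisor of `C`** (any field). [folklore] -/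
theorem mk_X_one_mem_nonZeroDivisors (g₁ g₂ : MvPolynomial (Fin 6) k) (hg₁ : g₁ = X 0 ^ 2 - X 2 * X 1)
    (hg₂ : g₂ = X 5 ^ 2 + X 1 * (1 + X 2 ^ 2 * X 5 + X 3 ^ 3 + X 4 ^ 3)) :
    Ideal.Quotient.mk (Ideal.span {g₁, g₂}) (X 1) ∈ nonZeroDivisors (MvPolynomial (Fin 6) k ⧸ Ideal.span {g₁, g₂}) := by
  have hp := prime_g₁' k _ rfl
  refine mem_nonZeroDivisors_iff_right.mpr fun c hc => ?_
  obtain ⟨r, s, rfl⟩ := exists_normalForm k g₁ g₂ hg₂ c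
  have c1 : (Fin.castSucc (1 : Fin 5) : Fin 6) = 1 := rfl
  have h0 : Ideal.Quotient.mk (Ideal.span {g₁, g₂}) (rename Fin.castSucc (r * X 1)) +
      Ideal.Quotient.mk (Ideal.span {g₁, g₂}) (rename Fin.castSucc (s * X 1)) * Ideal.Quotient.mk (Ideal.span {g₁, g₂}) (X 5) = 0 := by
    rw [← hc]; simp only [map_mul, rename_X, c1]; ring
  obtain ⟨hr, hs⟩ := dvd_of_normalForm_eq_zero k g₁ g₂ hg₁ hg₂ _ _ h0
  have hr' := (hp.dvd_or_dvd hr).resolve_right (not_dvd_X_one k _ rfl)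
  have hs' := (hp.dvd_or_dvd hs).resolve_right (not_dvd_X_one k _ rfl)
  rw [mk_rename_eq_zero_of_dvd k g₁ g₂ hg₁ r hr', mk_rename_eq_zero_of_dvd k g₁ g₂ hg₁ s hs', zero_mul, add_zero]

/-! ## §2 The chart map `C → A₀[1/ȳ]` and the blow-down map `A₀ → C` -/

set_option synthInstance.maxHeartbeats 200000 in
set_option maxHeartbeats 1600000 in
-- instance search on `Localization.Away` over the quotient ring is slow; the proof itself is two ring identities
/-- ★ **The chart map** `φ : C → A₀[1/ȳ]`: `x, y ↦ x, y`, `w ↦ x²/y`, `u′ ↦ u/y`, `t′ ↦ t/y`, `z′ ↦ z/y` (`g₁ ↦ 0`, `g₂ ↦ y⁻²·f = 0`). [folklore] -/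
theorem exists_chartMap (f : MvPolynomial (Fin 5) k) (hf : f = X 4 ^ 2 + X 0 ^ 4 * X 4 + X 1 ^ 3 + X 2 ^ 3 + X 3 ^ 3)
    (g₁ g₂ : MvPolynomial (Fin 6) k) (hg₁ : g₁ = X 0 ^ 2 - X 2 * X 1) (hg₂ : g₂ = X 5 ^ 2 + X 1 * (1 + X 2 ^ 2 * X 5 + X 3 ^ 3 + X 4 ^ 3)) :
    ∃ φ : (MvPolynomial (Fin 6) k ⧸ Ideal.span {g₁, g₂}) →+*
        Localization.Away (Ideal.Quotient.mk (Ideal.span {f}) (X 1) : MvPolynomial (Fin 5) k ⧸ Ideal.span {f}),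
      (∀ j : Fin 6, φ (Ideal.Quotient.mk (Ideal.span {g₁, g₂}) (X j)) =
        ![algebraMap (MvPolynomial (Fin 5) k ⧸ Ideal.span {f}) (Localization.Away (Ideal.Quotient.mk (Ideal.span {f}) (X 1) : MvPolynomial (Fin 5) k ⧸ Ideal.span {f})) (Ideal.Quotient.mk (Ideal.span {f}) (X 0)), algebraMap (MvPolynomial (Fin 5) k ⧸ Ideal.span {f}) (Localization.Away (Ideal.Quotient.mk (Ideal.span {f}) (X 1) : MvPolynomial (Fin 5) k ⧸ Ideal.span {f})) (Ideal.Quotient.mk (Ideal.span {f}) (X 1)),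
          algebraMap (MvPolynomial (Fin 5) k ⧸ Ideal.span {f}) (Localization.Away (Ideal.Quotient.mk (Ideal.span {f}) (X 1) : MvPolynomial (Fin 5) k ⧸ Ideal.span {f})) (Ideal.Quotient.mk (Ideal.span {f}) (X 0)) ^ 2 * Away.invSelf (Ideal.Quotient.mk (Ideal.span {f}) (X 1)),
          algebraMap (MvPolynomial (Fin 5) k ⧸ Ideal.span {f}) (Localization.Away (Ideal.Quotient.mk (Ideal.span {f}) (X 1) : MvPolynomial (Fin 5) k ⧸ Ideal.span {f})) (Ideal.Quotient.mk (Ideal.span {f}) (X 2)) * Away.invSelf (Ideal.Quotient.mk (Ideal.span {f}) (X 1)),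
          algebraMap (MvPolynomial (Fin 5) k ⧸ Ideal.span {f}) (Localization.Away (Ideal.Quotient.mk (Ideal.span {f}) (X 1) : MvPolynomial (Fin 5) k ⧸ Ideal.span {f})) (Ideal.Quotient.mk (Ideal.span {f}) (X 3)) * Away.invSelf (Ideal.Quotient.mk (Ideal.span {f}) (X 1)),
          algebraMap (MvPolynomial (Fin 5) k ⧸ Ideal.span {f}) (Localization.Away (Ideal.Quotient.mk (Ideal.span {f}) (X 1) : MvPolynomial (Fin 5) k ⧸ Ideal.span {f})) (Ideal.Quotient.mk (Ideal.span {f}) (X 4)) * Away.invSelf (Ideal.Quotient.mk (Ideal.span {f}) (X 1))] j) ∧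
      (∀ a : k, φ (Ideal.Quotient.mk (Ideal.span {g₁, g₂}) (C a)) = algebraMap (MvPolynomial (Fin 5) k ⧸ Ideal.span {f}) (Localization.Away (Ideal.Quotient.mk (Ideal.span {f}) (X 1) : MvPolynomial (Fin 5) k ⧸ Ideal.span {f})) (Ideal.Quotient.mk (Ideal.span {f}) (C a))) := by
  -- the two relations in `L = A₀[1/ȳ]`, then generalize the six atoms (keeps `ring` cheap)
  have hyi : algebraMap (MvPolynomial (Fin 5) k ⧸ Ideal.span {f}) (Localization.Away (Ideal.Quotient.mk (Ideal.span {f}) (X 1) :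
      MvPolynomial (Fin 5) k ⧸ Ideal.span {f})) (Ideal.Quotient.mk (Ideal.span {f}) (X 1)) * Away.invSelf (Ideal.Quotient.mk (Ideal.span {f}) (X 1)) = 1 :=
    Away.mul_invSelf _
  have hF : algebraMap (MvPolynomial (Fin 5) k ⧸ Ideal.span {f}) (Localization.Away (Ideal.Quotient.mk (Ideal.span {f}) (X 1) :
      MvPolynomial (Fin 5) k ⧸ Ideal.span {f})) (Ideal.Quotient.mk (Ideal.span {f}) (X 4)) ^ 2 +
      algebraMap (MvPolynomial (Fin 5) k ⧸ Ideal.span {f}) (Localization.Away (Ideal.Quotient.mk (Ideal.span {f}) (X 1) : MvPolynomial (Fin 5) k ⧸ Ideal.span {f})) (Ideal.Quotient.mk (Ideal.span {f}) (X 0)) ^ 4 * algebraMap (MvPolynomial (Fin 5) k ⧸ Ideal.span {f}) (Localization.Away (Ideal.Quotient.mk (Ideal.span {f}) (X 1) : MvPolynomial (Fin 5) k ⧸ Ideal.span {f})) (Ideal.Quotient.mk (Ideal.span {f}) (X 4)) +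
      algebraMap (MvPolynomial (Fin 5) k ⧸ Ideal.span {f}) (Localization.Away (Ideal.Quotient.mk (Ideal.span {f}) (X 1) : MvPolynomial (Fin 5) k ⧸ Ideal.span {f})) (Ideal.Quotient.mk (Ideal.span {f}) (X 1)) ^ 3 + algebraMap (MvPolynomial (Fin 5) k ⧸ Ideal.span {f}) (Localization.Away (Ideal.Quotient.mk (Ideal.span {f}) (X 1) : MvPolynomial (Fin 5) k ⧸ Ideal.span {f})) (Ideal.Quotient.mk (Ideal.span {f}) (X 2)) ^ 3 +
      algebraMap (MvPolynomial (Fin 5) k ⧸ Ideal.span {f}) (Localization.Away (Ideal.Quotient.mk (Ideal.span {f}) (X 1) : MvPolynomial (Fin 5) k ⧸ Ideal.span {f})) (Ideal.Quotient.mk (Ideal.span {f}) (X 3)) ^ 3 = 0 := by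
    have h0 : Ideal.Quotient.mk (Ideal.span {f}) (X 4 ^ 2 + X 0 ^ 4 * X 4 + X 1 ^ 3 + X 2 ^ 3 + X 3 ^ 3) = 0 := by
      rw [← hf]; exact Ideal.Quotient.eq_zero_iff_mem.mpr (Ideal.mem_span_singleton_self f)
    have := congrArg (algebraMap (MvPolynomial (Fin 5) k ⧸ Ideal.span {f})
      (Localization.Away (Ideal.Quotient.mk (Ideal.span {f}) (X 1) : MvPolynomial (Fin 5) k ⧸ Ideal.span {f}))) h0
    simpa only [map_add, map_mul, map_pow, map_zero] using this
  have hCa : ∀ a : k, algebraMap k (Localization.Away (Ideal.Quotient.mk (Ideal.span {f}) (X 1) : MvPolynomial (Fin 5) k ⧸ Ideal.span {f})) a =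
      algebraMap (MvPolynomial (Fin 5) k ⧸ Ideal.span {f}) (Localization.Away (Ideal.Quotient.mk (Ideal.span {f}) (X 1) : MvPolynomial (Fin 5) k ⧸ Ideal.span {f})) (Ideal.Quotient.mk (Ideal.span {f}) (C a)) := fun a => by
    rw [IsScalarTower.algebraMap_apply k (MvPolynomial (Fin 5) k ⧸ Ideal.span {f})]; rfl
  generalize (Away.invSelf (Ideal.Quotient.mk (Ideal.span {f}) (X 1) : MvPolynomial (Fin 5) k ⧸ Ideal.span {f}) :
    Localization.Away (Ideal.Quotient.mk (Ideal.span {f}) (X 1) : MvPolynomial (Fin 5) k ⧸ Ideal.span {f})) = i at hyi ⊢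
  generalize algebraMap (MvPolynomial (Fin 5) k ⧸ Ideal.span {f}) (Localization.Away (Ideal.Quotient.mk (Ideal.span {f}) (X 1) :
      MvPolynomial (Fin 5) k ⧸ Ideal.span {f})) (Ideal.Quotient.mk (Ideal.span {f}) (X 0)) = a0 at hF ⊢
  generalize algebraMap (MvPolynomial (Fin 5) k ⧸ Ideal.span {f}) (Localization.Away (Ideal.Quotient.mk (Ideal.span {f}) (X 1) :
      MvPolynomial (Fin 5) k ⧸ Ideal.span {f})) (Ideal.Quotient.mk (Ideal.span {f}) (X 1)) = a1 at hF hyi ⊢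
  generalize algebraMap (MvPolynomial (Fin 5) k ⧸ Ideal.span {f}) (Localization.Away (Ideal.Quotient.mk (Ideal.span {f}) (X 1) :
      MvPolynomial (Fin 5) k ⧸ Ideal.span {f})) (Ideal.Quotient.mk (Ideal.span {f}) (X 2)) = a2 at hF ⊢
  generalize algebraMap (MvPolynomial (Fin 5) k ⧸ Ideal.span {f}) (Localization.Away (Ideal.Quotient.mk (Ideal.span {f}) (X 1) :
      MvPolynomial (Fin 5) k ⧸ Ideal.span {f})) (Ideal.Quotient.mk (Ideal.span {f}) (X 3)) = a3 at hF ⊢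
  generalize algebraMap (MvPolynomial (Fin 5) k ⧸ Ideal.span {f}) (Localization.Away (Ideal.Quotient.mk (Ideal.span {f}) (X 1) :
      MvPolynomial (Fin 5) k ⧸ Ideal.span {f})) (Ideal.Quotient.mk (Ideal.span {f}) (X 4)) = a4 at hF ⊢
  -- the substitution
  let v : Fin 6 → Localization.Away (Ideal.Quotient.mk (Ideal.span {f}) (X 1) : MvPolynomial (Fin 5) k ⧸ Ideal.span {f}) :=
    ![a0, a1, a0 ^ 2 * i, a2 * i, a3 * i, a4 * i]
  have hv0 : v 0 = a0 := rfl
  have hv1 : v 1 = a1 := rfl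
  have hv2 : v 2 = a0 ^ 2 * i := rfl
  have hv3 : v 3 = a2 * i := rfl
  have hv4 : v 4 = a3 * i := rfl
  have hv5 : v 5 = a4 * i := rfl
  have hφg₁ : aeval v g₁ = 0 := by
    rw [hg₁]
    simp only [map_sub, map_mul, map_pow, aeval_X, hv0, hv1, hv2]
    linear_combination (-(a0 ^ 2)) * hyi
  have hφg₂ : aeval v g₂ = 0 := by
    rw [hg₂]
    simp only [map_add, map_mul, map_pow, map_one, aeval_X, hv1, hv2, hv3, hv4, hv5]
    linear_combination (i ^ 2) * hF + (-(a1 * (1 + a1 * i)) + i ^ 2 * a0 ^ 4 * a4 + i ^ 2 * a2 ^ 3 + i ^ 2 * a3 ^ 3) * hyi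
  have hker : ∀ a ∈ Ideal.span {g₁, g₂}, (aeval v).toRingHom a = 0 := by
    intro a ha
    obtain ⟨c, d, rfl⟩ := Ideal.mem_span_pair.mp ha
    rw [AlgHom.toRingHom_eq_coe, RingHom.coe_coe, map_add, map_mul, map_mul, hφg₁, hφg₂, mul_zero, mul_zero, add_zero]
  refine ⟨Ideal.Quotient.lift (Ideal.span {g₁, g₂}) (aeval v).toRingHom hker, fun j => ?_, fun a => ?_⟩
  · rw [Ideal.Quotient.lift_mk, AlgHom.toRingHom_eq_coe, RingHom.coe_coe, aeval_X]
  · rw [Ideal.Quotient.lift_mk, AlgHom.toRingHom_eq_coe, RingHom.coe_coe, aeval_C, hCa]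

/-- ★ **The blow-down map** `ψ₁ : A₀ → C`: `x, y ↦ x̄, ȳ`, `u ↦ ū′ȳ`, `t ↦ t̄′ȳ`, `z ↦ z̄′ȳ` (`f ↦ ȳ²·ḡ₂ − z̄′ȳ(x̄² + w̄ȳ)·ḡ₁ = 0`). [folklore] -/
theorem exists_blowdownMap (f : MvPolynomial (Fin 5) k) (hf : f = X 4 ^ 2 + X 0 ^ 4 * X 4 + X 1 ^ 3 + X 2 ^ 3 + X 3 ^ 3)
    (g₁ g₂ : MvPolynomial (Fin 6) k) (hg₁ : g₁ = X 0 ^ 2 - X 2 * X 1) (hg₂ : g₂ = X 5 ^ 2 + X 1 * (1 + X 2 ^ 2 * X 5 + X 3 ^ 3 + X 4 ^ 3)) :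
    ∃ ψ₁ : (MvPolynomial (Fin 5) k ⧸ Ideal.span {f}) →+* (MvPolynomial (Fin 6) k ⧸ Ideal.span {g₁, g₂}),
      (∀ j : Fin 5, ψ₁ (Ideal.Quotient.mk (Ideal.span {f}) (X j)) =
        ![Ideal.Quotient.mk (Ideal.span {g₁, g₂}) (X 0), Ideal.Quotient.mk (Ideal.span {g₁, g₂}) (X 1),
          Ideal.Quotient.mk (Ideal.span {g₁, g₂}) (X 3) * Ideal.Quotient.mk (Ideal.span {g₁, g₂}) (X 1),
          Ideal.Quotient.mk (Ideal.span {g₁, g₂}) (X 4) * Ideal.Quotient.mk (Ideal.span {g₁, g₂}) (X 1),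
          Ideal.Quotient.mk (Ideal.span {g₁, g₂}) (X 5) * Ideal.Quotient.mk (Ideal.span {g₁, g₂}) (X 1)] j) ∧
      (∀ a : k, ψ₁ (Ideal.Quotient.mk (Ideal.span {f}) (C a)) = Ideal.Quotient.mk (Ideal.span {g₁, g₂}) (C a)) := by
  set mkC : MvPolynomial (Fin 6) k →+* MvPolynomial (Fin 6) k ⧸ Ideal.span {g₁, g₂} := Ideal.Quotient.mk (Ideal.span {g₁, g₂}) with hmkC
  set w : Fin 5 → MvPolynomial (Fin 6) k ⧸ Ideal.span {g₁, g₂} :=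
    ![mkC (X 0), mkC (X 1), mkC (X 3) * mkC (X 1), mkC (X 4) * mkC (X 1), mkC (X 5) * mkC (X 1)] with hw
  have hwy := mk_X_two_mul_X_one k g₁ g₂ hg₁
  have hz := sq_z_eq k g₁ g₂ hg₂
  have hw0 : w 0 = mkC (X 0) := rfl
  have hw1 : w 1 = mkC (X 1) := rfl
  have hw2 : w 2 = mkC (X 3) * mkC (X 1) := rfl
  have hw3 : w 3 = mkC (X 4) * mkC (X 1) := rfl
  have hw4 : w 4 = mkC (X 5) * mkC (X 1) := rfl
  have hψf : aeval w f = 0 := by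
    rw [hf]
    simp only [map_add, map_mul, map_pow, aeval_X, hw0, hw1, hw2, hw3, hw4]
    rw [← hmkC] at hwy hz
    linear_combination (mkC (X 1)) ^ 2 * hz + (-(mkC (X 5) * mkC (X 1) * (mkC (X 0) ^ 2 + mkC (X 2) * mkC (X 1)))) * hwy
  have hker : ∀ a ∈ Ideal.span {f}, (aeval w).toRingHom a = 0 := by
    intro a ha
    obtain ⟨c, rfl⟩ := Ideal.mem_span_singleton.mp ha
    rw [AlgHom.toRingHom_eq_coe, RingHom.coe_coe, map_mul, hψf, zero_mul]
  refine ⟨Ideal.Quotient.lift (Ideal.span {f}) (aeval w).toRingHom hker, fun j => ?_, fun a => ?_⟩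
  · rw [Ideal.Quotient.lift_mk, AlgHom.toRingHom_eq_coe, RingHom.coe_coe, aeval_X]
  · rw [Ideal.Quotient.lift_mk, AlgHom.toRingHom_eq_coe, RingHom.coe_coe, aeval_C]
    rfl

set_option synthInstance.maxHeartbeats 200000 in
set_option maxHeartbeats 1600000 in
-- one `IsLocalization` lift + a generator-by-generator comparison of two ring maps out of a quotient of `k[X₀..X₅]`
/-- ★ **The chart map is injective**: the blow-down map, extended to `A₀[1/ȳ] → C[1/ȳ]`, composed with `φ` is the localisation map `C → C[1/ȳ]`
(check on generators: e.g. `w ↦ x²/y ↦ x̄²/ȳ = w̄`), and `C → C[1/ȳ]` is injective because `ȳ` is a non-zero-divisor (§1). [folklore] -/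
theorem chartMap_injective (f : MvPolynomial (Fin 5) k) (hf : f = X 4 ^ 2 + X 0 ^ 4 * X 4 + X 1 ^ 3 + X 2 ^ 3 + X 3 ^ 3)
    (g₁ g₂ : MvPolynomial (Fin 6) k) (hg₁ : g₁ = X 0 ^ 2 - X 2 * X 1) (hg₂ : g₂ = X 5 ^ 2 + X 1 * (1 + X 2 ^ 2 * X 5 + X 3 ^ 3 + X 4 ^ 3))
    (φ : (MvPolynomial (Fin 6) k ⧸ Ideal.span {g₁, g₂}) →+*
        Localization.Away (Ideal.Quotient.mk (Ideal.span {f}) (X 1) : MvPolynomial (Fin 5) k ⧸ Ideal.span {f}))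
    (hφX : ∀ j : Fin 6, φ (Ideal.Quotient.mk (Ideal.span {g₁, g₂}) (X j)) =
        ![algebraMap (MvPolynomial (Fin 5) k ⧸ Ideal.span {f}) (Localization.Away (Ideal.Quotient.mk (Ideal.span {f}) (X 1) : MvPolynomial (Fin 5) k ⧸ Ideal.span {f})) (Ideal.Quotient.mk (Ideal.span {f}) (X 0)), algebraMap (MvPolynomial (Fin 5) k ⧸ Ideal.span {f}) (Localization.Away (Ideal.Quotient.mk (Ideal.span {f}) (X 1) : MvPolynomial (Fin 5) k ⧸ Ideal.span {f})) (Ideal.Quotient.mk (Ideal.span {f}) (X 1)),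
          algebraMap (MvPolynomial (Fin 5) k ⧸ Ideal.span {f}) (Localization.Away (Ideal.Quotient.mk (Ideal.span {f}) (X 1) : MvPolynomial (Fin 5) k ⧸ Ideal.span {f})) (Ideal.Quotient.mk (Ideal.span {f}) (X 0)) ^ 2 * Away.invSelf (Ideal.Quotient.mk (Ideal.span {f}) (X 1)),
          algebraMap (MvPolynomial (Fin 5) k ⧸ Ideal.span {f}) (Localization.Away (Ideal.Quotient.mk (Ideal.span {f}) (X 1) : MvPolynomial (Fin 5) k ⧸ Ideal.span {f})) (Ideal.Quotient.mk (Ideal.span {f}) (X 2)) * Away.invSelf (Ideal.Quotient.mk (Ideal.span {f}) (X 1)),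
          algebraMap (MvPolynomial (Fin 5) k ⧸ Ideal.span {f}) (Localization.Away (Ideal.Quotient.mk (Ideal.span {f}) (X 1) : MvPolynomial (Fin 5) k ⧸ Ideal.span {f})) (Ideal.Quotient.mk (Ideal.span {f}) (X 3)) * Away.invSelf (Ideal.Quotient.mk (Ideal.span {f}) (X 1)),
          algebraMap (MvPolynomial (Fin 5) k ⧸ Ideal.span {f}) (Localization.Away (Ideal.Quotient.mk (Ideal.span {f}) (X 1) : MvPolynomial (Fin 5) k ⧸ Ideal.span {f})) (Ideal.Quotient.mk (Ideal.span {f}) (X 4)) * Away.invSelf (Ideal.Quotient.mk (Ideal.span {f}) (X 1))] j)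
    (hφC : ∀ a : k, φ (Ideal.Quotient.mk (Ideal.span {g₁, g₂}) (C a)) = algebraMap (MvPolynomial (Fin 5) k ⧸ Ideal.span {f}) (Localization.Away (Ideal.Quotient.mk (Ideal.span {f}) (X 1) : MvPolynomial (Fin 5) k ⧸ Ideal.span {f})) (Ideal.Quotient.mk (Ideal.span {f}) (C a))) :
    Function.Injective φ := by
  classical
  let mkA : MvPolynomial (Fin 5) k →+* MvPolynomial (Fin 5) k ⧸ Ideal.span {f} := Ideal.Quotient.mk (Ideal.span {f})
  let mkC : MvPolynomial (Fin 6) k →+* MvPolynomial (Fin 6) k ⧸ Ideal.span {g₁, g₂} := Ideal.Quotient.mk (Ideal.span {g₁, g₂})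
  let ιC : (MvPolynomial (Fin 6) k ⧸ Ideal.span {g₁, g₂}) →+* Localization.Away (mkC (X 1)) := algebraMap _ _
  -- `C → C[1/ȳ]` is injective
  have hιC_inj : Function.Injective ιC :=
    IsLocalization.injective (Localization.Away (mkC (X 1))) (M := Submonoid.powers (mkC (X 1)))
      ((Submonoid.powers_le (P := nonZeroDivisors _)).mpr (mk_X_one_mem_nonZeroDivisors k g₁ g₂ hg₁ hg₂))
  -- the blow-down map and its extension `ψ : A₀[1/ȳ] → C[1/ȳ]`
  obtain ⟨ψ₁, hψX, hψC⟩ := exists_blowdownMap k f hf g₁ g₂ hg₁ hg₂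
  have hunit : IsUnit ((ιC.comp ψ₁) (mkA (X 1))) := by
    rw [RingHom.comp_apply, hψX]
    exact IsLocalization.Away.algebraMap_isUnit (mkC (X 1))
  let ψ : Localization.Away (mkA (X 1)) →+* Localization.Away (mkC (X 1)) := IsLocalization.Away.lift (mkA (X 1)) hunit
  have hψι : ∀ a, ψ (algebraMap _ (Localization.Away (mkA (X 1))) a) = ιC (ψ₁ a) := fun a => IsLocalization.Away.lift_eq (mkA (X 1)) hunit a
  -- `ψ ∘ φ = ιC`
  have hyu : IsUnit (ιC (mkC (X 1))) := IsLocalization.Away.algebraMap_isUnit (mkC (X 1))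
  have hψi : ψ (Away.invSelf (mkA (X 1))) * ιC (mkC (X 1)) = 1 := by
    have h1 : ψ (Away.invSelf (mkA (X 1))) * ψ (algebraMap _ (Localization.Away (mkA (X 1))) (mkA (X 1))) = 1 := by
      rw [← map_mul, mul_comm, Away.mul_invSelf, map_one]
    rwa [hψι, hψX] at h1
  have hwy : mkC (X 2) * mkC (X 1) = mkC (X 0) ^ 2 := mk_X_two_mul_X_one k g₁ g₂ hg₁
  have hcomp : ψ.comp φ = ιC := by
    refine Ideal.Quotient.ringHom_ext (MvPolynomial.ringHom_ext (fun a => ?_) (fun j => ?_))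
    · change ψ (φ (mkC (C a))) = ιC (mkC (C a))
      rw [hφC, hψι, hψC]
    · change ψ (φ (mkC (X j))) = ιC (mkC (X j))
      rw [hφX]
      fin_cases j
      · simp only [Fin.zero_eta, Fin.isValue, Matrix.cons_val_zero]
        rw [hψι, hψX]; rfl
      · simp only [Fin.mk_one, Fin.isValue, Matrix.cons_val_one, Matrix.cons_val_zero]
        rw [hψι, hψX]; rfl
      · simp only [Fin.reduceFinMk, Matrix.cons_val]
        rw [map_mul, map_pow, hψι, hψX]
        apply hyu.mul_left_injective
        change ιC (mkC (X 0)) ^ 2 * ψ (Away.invSelf (mkA (X 1))) * ιC (mkC (X 1)) = ιC (mkC (X 2)) * ιC (mkC (X 1))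
        rw [mul_assoc, hψi, mul_one, ← map_pow, ← map_mul, hwy]
      · simp only [Fin.reduceFinMk, Matrix.cons_val]
        rw [map_mul, hψι, hψX]
        apply hyu.mul_left_injective
        change ιC (mkC (X 3) * mkC (X 1)) * ψ (Away.invSelf (mkA (X 1))) * ιC (mkC (X 1)) = ιC (mkC (X 3)) * ιC (mkC (X 1))
        rw [mul_assoc, hψi, mul_one, map_mul]
      · simp only [Fin.reduceFinMk, Matrix.cons_val]
        rw [map_mul, hψι, hψX]
        apply hyu.mul_left_injective
        change ιC (mkC (X 4) * mkC (X 1)) * ψ (Away.invSelf (mkA (X 1))) * ιC (mkC (X 1)) = ιC (mkC (X 4)) * ιC (mkC (X 1))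
        rw [mul_assoc, hψi, mul_one, map_mul]
      · simp only [Fin.reduceFinMk, Matrix.cons_val]
        rw [map_mul, hψι, hψX]
        apply hyu.mul_left_injective
        change ιC (mkC (X 5) * mkC (X 1)) * ψ (Away.invSelf (mkA (X 1))) * ιC (mkC (X 1)) = ιC (mkC (X 5)) * ιC (mkC (X 1))
        rw [mul_assoc, hψi, mul_one, map_mul]
  have h2 : Function.Injective (⇑ψ ∘ ⇑φ) := by rw [← RingHom.coe_comp, hcomp]; exact hιC_inj
  exact h2.of_comp

/-! ## §3 `C` is an integral domain -/

set_option synthInstance.maxHeartbeats 200000 in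
/-- ★★ **The CI chart ring `C` is an integral domain**: it embeds (`chartMap_injective`) into `A₀[1/ȳ]`, a localisation of the domain `A₀` (`f` prime).
[folklore] -/
theorem isDomain [CharP k 2] (f : MvPolynomial (Fin 5) k) (hf : f = X 4 ^ 2 + X 0 ^ 4 * X 4 + X 1 ^ 3 + X 2 ^ 3 + X 3 ^ 3)
    (g₁ g₂ : MvPolynomial (Fin 6) k) (hg₁ : g₁ = X 0 ^ 2 - X 2 * X 1) (hg₂ : g₂ = X 5 ^ 2 + X 1 * (1 + X 2 ^ 2 * X 5 + X 3 ^ 3 + X 4 ^ 3)) :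
    IsDomain (MvPolynomial (Fin 6) k ⧸ Ideal.span {g₁, g₂}) := by
  haveI hfp : (Ideal.span {f}).IsPrime :=
    (Ideal.span_singleton_prime (FCentreE1ChartWitness.prime_f k f hf).ne_zero).mpr (FCentreE1ChartWitness.prime_f k f hf)
  haveI : IsDomain (MvPolynomial (Fin 5) k ⧸ Ideal.span {f}) := Ideal.Quotient.isDomain _
  have hy0 : (Ideal.Quotient.mk (Ideal.span {f}) (X 1) : MvPolynomial (Fin 5) k ⧸ Ideal.span {f}) ≠ 0 :=
    FCentreE1ChartPresentation.mk_X_ne_zero_of_eval k f hfp 1 (Pi.single 4 1) (by simp) (by rw [hf]; simp)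
  haveI : IsDomain (Localization.Away (Ideal.Quotient.mk (Ideal.span {f}) (X 1) : MvPolynomial (Fin 5) k ⧸ Ideal.span {f})) :=
    IsLocalization.isDomain_of_le_nonZeroDivisors _ (powers_le_nonZeroDivisors_of_noZeroDivisors hy0)
  obtain ⟨φ, hφX, hφC⟩ := exists_chartMap k f hf g₁ g₂ hg₁ hg₂
  exact Function.Injective.isDomain φ (chartMap_injective k f hf g₁ g₂ hg₁ hg₂ φ hφX hφC)

/-- Hence `(g₁, g₂)` is a prime ideal of `k[X₀..X₅]`. [folklore] -/
theorem isPrime_span_pair [CharP k 2] (f : MvPolynomial (Fin 5) k) (hf : f = X 4 ^ 2 + X 0 ^ 4 * X 4 + X 1 ^ 3 + X 2 ^ 3 + X 3 ^ 3)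
    (g₁ g₂ : MvPolynomial (Fin 6) k) (hg₁ : g₁ = X 0 ^ 2 - X 2 * X 1) (hg₂ : g₂ = X 5 ^ 2 + X 1 * (1 + X 2 ^ 2 * X 5 + X 3 ^ 3 + X 4 ^ 3)) :
    (Ideal.span {g₁, g₂} : Ideal (MvPolynomial (Fin 6) k)).IsPrime := by
  haveI := isDomain k f hf g₁ g₂ hg₁ hg₂
  exact (Ideal.Quotient.isDomain_iff_prime _).mp ‹_›

end Summit.ResolutionOfSingularities.ResolutionOfSingularities.Theorems.FInjectiveMacaulayfication.TauFloorOneCIChartDomain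

end
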